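import Summits.AtomisticToContinuum.HydrodynamicLimit.Theorems.CollisionIsometryCLTAdaptedWeightCLTTimeLocal

/-!
# Column depolarisation, part B: the DEPOLARISATION BALANCE of the impulse clouds along the fold,
# and the two typed inputs the rank-2 mechanism consumes beyond H1
(helpers for the registered stub `stub_columnDepolarisation` of the line `contact-source-duhamel`,
crux `CollisionIsometryCLT.AdaptedWeightCLT`, stmt-AtomisticToContinuum-14868; `--supports`,
anchor `normSqT_cloud_succ`)

## What is proved (exact algebra, every `σ`)
For the rank-2 cloud `J_s = cloud 2 σ N y s k a` of an impulse `a` injected at `k`, its anisotropy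
`A_s = J_s − |a|²𝟙/3` (`anisT`) and its realised one-step decrement `X_s = J_s − J_{s+1}` (`dropT`):
`‖A_{s+1}‖² = ‖A_s‖² − 2⟨A_s, X_s⟩ + ‖X_s‖²` (`normSqT_cloud_succ`), telescoped over any stretch of
fold steps (`normSqT_anisT_telescope`) and averaged over injection sites and the nine probes `dirV`:
`anisF m₂ = anisF m₁ − 2·workF m₁ m₂ + quadF m₁ m₂` (`anisF_telescope`), with `cd2 σ N y Δ =
anisF σ N y (steps σ N y Δ)` (`cd2_eq_anisF`). Here `workF` is the cloud-averaged REALISED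
first-order depolarisation work `Σ_s ⟨A_s, X_s⟩` and `quadF` the second-order floor `Σ_s ‖X_s‖²`.
(At a step reflecting `(p,q)` with normal `n`, `X_s = Q S P + P S Q` for the PAIR TENSOR
`S = T_p + T_q` (`pairTens`), whence `‖X_s‖² ≤ ½ (tr S)²`; under a normal UNIFORM on `S²` and
independent of `S`, `E X_s = (2/5) S₀` and `E ‖X_s‖² = (2/5)‖S₀‖²`, `S₀` the trace-free part — the
planner's `E Δ‖J − 𝟙/3‖² = −(4/5) mᵀ(J − 𝟙/3)m + (4/15)|m|⁴` for a single piece `S = m mᵀ`.)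

## What is typed (two `Prop`-valued predicates, asserted nowhere)
* `IncoherentDiffuseAt σ a₀ θ₀ u₀ Φ`: the INCOHERENT twin of H1 on the line window — the carrier
  participation of the clouds of all probe impulses at the end of the window (`carrPartF`) and the
  collision-integrated pair participation over its second half (`pairPartF`) vanish in local-Gibbs
  mean. It is the floor of the balance (`quadF ≤ ½ pairPartF`) and bounds `cd3x` outright
  (`‖cloud₃‖² ≤ |a|² Σ_w |piece_w|⁴ ≤ |a|² Σ_i (tr T_i)²`, part A); on forest windows it IS H1
  (coherent = incoherent), in general the two differ by interference terms.
* `OneStepNondegenerateAt σ a₀ θ₀ u₀ Φ` (OSN, in the integrated one-sided form the mechanism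
  consumes): for some `c₀ > 0` and every `K`, on every FINAL STRETCH of at most `K(N+1)` fold steps
  of the line window, `workF ≥ c₀ (N+1)⁻¹ Σ_s anisF s` up to an error whose positive part vanishes in
  local-Gibbs mean. It holds with `c₀ = 4/5 − o(1)` if, given the coarse past and the reflected
  pair, the normal is uniform on `S²` and the pair is a fair sample of the carriers
  (`E[X_s | past] = (2/5)(S_s)₀`, `E[S_s | past] = (2/(N+1)) J_s`): a one-memory-back Stosszahlansatz
  for NORMALS AND PAIRS tested against the tensors the clouds carry, N-uniform, along the
  non-equilibrium law. Mere coercivity of the conditional normal law is NOT enough (an adapted,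
  past-dependent remainder anti-depolarises at first order `~‖A‖·|m|²` against the second-order gain).

## Why the registered stub needs them (evidence, not a proof)
H1 constrains the COHERENT transfer `M`; `cd2` is a functional of the INCOHERENT transport `𝒯`.
(i) Abstract folds with recollision towers: 10 reflections of 3 particles with explicit normals
realise `M = c ⊗ 𝟙₃`, `c` the rotation by `π/3` about `(1,1,1)` (rows `(2/3, 2/3, −1/3)`; the pair
rotations generate `so(6)`), so the coherent clouds are EXACTLY undepolarised while `ipr = 11/3`;
iterated hierarchically on `3^h` particles, `ipr = 9 (11/27)^h → 0` but `cd2 → 0.076 > 0`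
(the incoherent cloud maps are trace-preserving, positive, NOT unital: anisotropic fixed point).
(ii) Coordinate or planar normals freeze both functionals (`reflectVel_of_inner_eq_zero`,
`one_le_ipr_of_planar`), consistently. (iii) Greedy adversarial normals on forests hold `cd2 ≈ 1.8`
while `ipr` stalls at `≈ 3×` its floor: the obstruction to a pathwise bound is real in both directions
only through recollisions. Hence `DiffuseAt → CDAlongAt` is not exact algebra plus measure theory; the
corrected stub reads `DiffuseAt → IncoherentDiffuseAt → OneStepNondegenerateAt → CDAlongAt` (proof
route: `anisF_telescope` on the last `K(N+1)` steps, `K ≫ 84/(c₀δ)`, forces a step `s*` with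
`anisF s* < δ`; OSN on `[s*, m)` and `quadF ≤ ½ pairPartF` give `cd2 ≤ δ + o(1)`; `cd3x ≤ 3·carrPartF`;
H1 supplies `≥ K(N+1)` collisions in the second half of the window, `row_ipr_floor`).
-/

namespace Summit.AtomisticToContinuum.HydrodynamicLimit.Theorems.ContactSourceDuhamel.TimeLocal
namespace ColumnDepolarisation

open scoped BigOperators Topology Classical MeasureTheory ENNReal InnerProductSpace
open Filter Set MeasureTheory
open Literature.Analysis.FluidPDE
open Literature.MathematicalPhysics.KineticTheory (hsDiameter localGibbsLaw)

noncomputable section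

variable {σ : ℝ} {N : ℕ} {y : Cfg N}

/-! ## Cloud trajectories: family, anisotropy, decrement, pair tensor -/

/-- The trace of a rank-2 tensor. -/
def trT (T : Tens 2) : ℝ := ∑ b : Fin 3, T (fun _ => b)

/-- The rank-2 cloud FAMILY of the impulse `a` injected at `k`, after `s` fold steps (carrier by
carrier; its sum over carriers is `cloud 2 σ N y s k a`). -/
def cfam (σ : ℝ) (N : ℕ) (y : Cfg N) (k : Fin (N + 1)) (a : V3) (s : ℕ) : Fin (N + 1) → Tens 2 :=
  tTransport 2 σ N y 0 s (Pi.single k (tpow 2 a))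

/-- The cloud is the sum of its family. -/
theorem cloud_two_eq_sum_cfam (k : Fin (N + 1)) (a : V3) (s : ℕ) :
    cloud 2 σ N y s k a = ∑ i, cfam σ N y k a s i := rfl

/-- The ANISOTROPY `A_s = J_s − |a|²𝟙/3` of the rank-2 cloud after `s` steps. -/
def anisT (σ : ℝ) (N : ℕ) (y : Cfg N) (k : Fin (N + 1)) (a : V3) (s : ℕ) : Tens 2 :=
  cloud 2 σ N y s k a - iso2 a

/-- The REALISED DECREMENT `X_s = J_s − J_{s+1}` of the rank-2 cloud at fold step `s`
(`= Q S P + P S Q` for the pair tensor `S` of the step; `0` at an identity step). -/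
def dropT (σ : ℝ) (N : ℕ) (y : Cfg N) (k : Fin (N + 1)) (a : V3) (s : ℕ) : Tens 2 :=
  cloud 2 σ N y s k a - cloud 2 σ N y (s + 1) k a

/-- The PAIR TENSOR `S_s = T_p + T_q` of the cloud at fold step `s`: the part of the cloud sitting on
the reflected pair (`0` at an identity step); `tr S_s` is the cloud energy exposed to the collision. -/
def pairTens (σ : ℝ) (N : ℕ) (y : Cfg N) (k : Fin (N + 1)) (a : V3) (s : ℕ) : Tens 2 :=
  match stepPair σ N y s with
  | none => 0
  | some pq => cfam σ N y k a s pq.1 + cfam σ N y k a s pq.2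

/-- `A_{s+1} = A_s − X_s`. -/
theorem anisT_succ (k : Fin (N + 1)) (a : V3) (s : ℕ) :
    anisT σ N y k a (s + 1) = anisT σ N y k a s - dropT σ N y k a s := by
  simp only [anisT, dropT]
  abel

/-- `‖X − Y‖² = ‖X‖² − 2⟨X, Y⟩ + ‖Y‖²` (polarisation). -/
theorem normSqT_sub' (X Y : Tens 2) :
    normSqT (X - Y) = normSqT X - 2 * pairT X Y + normSqT Y := by
  simp only [normSqT, pairT, Pi.sub_apply, sub_sq, Finset.sum_add_distrib, Finset.sum_sub_distrib,
    Finset.mul_sum, mul_assoc]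

/-- ONE STEP OF THE DEPOLARISATION BALANCE: `‖A_{s+1}‖² = ‖A_s‖² − 2⟨A_s, X_s⟩ + ‖X_s‖²`, stated
over the line's vocabulary only. -/
theorem normSqT_cloud_succ : ∀ (σ : ℝ) (N : ℕ) (y : Cfg N) (k : Fin (N + 1)) (a : V3) (s : ℕ),
    normSqT (cloud 2 σ N y (s + 1) k a - iso2 a) =
      normSqT (cloud 2 σ N y s k a - iso2 a) -
        2 * pairT (cloud 2 σ N y s k a - iso2 a) (cloud 2 σ N y s k a - cloud 2 σ N y (s + 1) k a) +
        normSqT (cloud 2 σ N y s k a - cloud 2 σ N y (s + 1) k a) := by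
  intro σ N y k a s
  rw [← normSqT_sub']
  congr 1
  abel

/-- The same step in the `anisT`/`dropT` notation. -/
theorem normSqT_anisT_succ (k : Fin (N + 1)) (a : V3) (s : ℕ) :
    normSqT (anisT σ N y k a (s + 1)) =
      normSqT (anisT σ N y k a s) - 2 * pairT (anisT σ N y k a s) (dropT σ N y k a s) +
        normSqT (dropT σ N y k a s) := by
  rw [anisT_succ, normSqT_sub']

/-- THE BALANCE OVER A STRETCH: `‖A_{m₁+n}‖² = ‖A_{m₁}‖² − 2 Σ_{s<n} ⟨A_{m₁+s}, X_{m₁+s}⟩ +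
Σ_{s<n} ‖X_{m₁+s}‖²`. -/
theorem normSqT_anisT_telescope (k : Fin (N + 1)) (a : V3) (m₁ n : ℕ) :
    normSqT (anisT σ N y k a (m₁ + n)) =
      normSqT (anisT σ N y k a m₁) -
        2 * ∑ s ∈ Finset.range n, pairT (anisT σ N y k a (m₁ + s)) (dropT σ N y k a (m₁ + s)) +
        ∑ s ∈ Finset.range n, normSqT (dropT σ N y k a (m₁ + s)) := by
  induction n with
  | zero => simp
  | succ n ih =>
      rw [← add_assoc, normSqT_anisT_succ, ih, Finset.sum_range_succ, Finset.sum_range_succ]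
      ring

/-! ## Cloud-averaged window functionals -/

/-- Cloud-averaged ANISOTROPY after `s` fold steps: `(N+1)⁻¹ Σ_k Σ_{pq} ‖A_s(k, dirV p q)‖²`
(so that `cd2 σ N y Δ = anisF σ N y (steps σ N y Δ)`). -/
def anisF (σ : ℝ) (N : ℕ) (y : Cfg N) (s : ℕ) : ℝ :=
  ((N + 1 : ℕ) : ℝ)⁻¹ * ∑ k : Fin (N + 1), ∑ p : Fin 3, ∑ q : Fin 3,
    normSqT (anisT σ N y k (dirV p q) s)

/-- Cloud-averaged REALISED DEPOLARISATION WORK over the fold steps `m₁ ≤ s < m₂`: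
`(N+1)⁻¹ Σ_k Σ_{pq} Σ_s ⟨A_s, X_s⟩`. -/
def workF (σ : ℝ) (N : ℕ) (y : Cfg N) (m₁ m₂ : ℕ) : ℝ :=
  ((N + 1 : ℕ) : ℝ)⁻¹ * ∑ k : Fin (N + 1), ∑ p : Fin 3, ∑ q : Fin 3,
    ∑ s ∈ Finset.Ico m₁ m₂, pairT (anisT σ N y k (dirV p q) s) (dropT σ N y k (dirV p q) s)

/-- Cloud-averaged SECOND-ORDER FLOOR over the fold steps `m₁ ≤ s < m₂`:
`(N+1)⁻¹ Σ_k Σ_{pq} Σ_s ‖X_s‖²`. -/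
def quadF (σ : ℝ) (N : ℕ) (y : Cfg N) (m₁ m₂ : ℕ) : ℝ :=
  ((N + 1 : ℕ) : ℝ)⁻¹ * ∑ k : Fin (N + 1), ∑ p : Fin 3, ∑ q : Fin 3,
    ∑ s ∈ Finset.Ico m₁ m₂, normSqT (dropT σ N y k (dirV p q) s)

/-- Cloud-averaged CARRIER PARTICIPATION after `s` steps, for the clouds of all probe impulses used
by `cd2` (`dirV`) and `cd3x` (`udir`): `(N+1)⁻¹ Σ_k (Σ_{pq} Σ_i (tr T_i)² + Σ_{p<10} Σ_i (tr T_i)²)`.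
It bounds `cd3x` (`≤ 3 ·` the `udir` part) and the piece participation `Σ_w |piece_w|⁴`. -/
def carrPartF (σ : ℝ) (N : ℕ) (y : Cfg N) (s : ℕ) : ℝ :=
  ((N + 1 : ℕ) : ℝ)⁻¹ * ∑ k : Fin (N + 1),
    ((∑ p : Fin 3, ∑ q : Fin 3, ∑ i : Fin (N + 1), trT (cfam σ N y k (dirV p q) s i) ^ 2) +
      ∑ p : Fin 10, ∑ i : Fin (N + 1), trT (cfam σ N y k (udir p) s i) ^ 2)

/-- Cloud-averaged COLLISION-INTEGRATED PAIR PARTICIPATION over the fold steps `m₁ ≤ s < m₂`: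
`(N+1)⁻¹ Σ_k Σ_{pq} Σ_s (tr S_s)²` (it dominates `2 · quadF m₁ m₂`). -/
def pairPartF (σ : ℝ) (N : ℕ) (y : Cfg N) (m₁ m₂ : ℕ) : ℝ :=
  ((N + 1 : ℕ) : ℝ)⁻¹ * ∑ k : Fin (N + 1), ∑ p : Fin 3, ∑ q : Fin 3,
    ∑ s ∈ Finset.Ico m₁ m₂, trT (pairTens σ N y k (dirV p q) s) ^ 2

/-- `cd2` is the cloud-averaged anisotropy at the window's step count. -/
theorem cd2_eq_anisF (Δ : ℝ) : cd2 σ N y Δ = anisF σ N y (steps σ N y Δ) := rfl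

/-- THE CLOUD-AVERAGED BALANCE: `anisF m₂ = anisF m₁ − 2 workF m₁ m₂ + quadF m₁ m₂` for `m₁ ≤ m₂`. -/
theorem anisF_telescope {m₁ m₂ : ℕ} (h : m₁ ≤ m₂) :
    anisF σ N y m₂ = anisF σ N y m₁ - 2 * workF σ N y m₁ m₂ + quadF σ N y m₁ m₂ := by
  obtain ⟨n, rfl⟩ := Nat.exists_eq_add_of_le h
  have key : ∀ (k : Fin (N + 1)) (p q : Fin 3),
      normSqT (anisT σ N y k (dirV p q) (m₁ + n)) =
        normSqT (anisT σ N y k (dirV p q) m₁) -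
          2 * ∑ s ∈ Finset.Ico m₁ (m₁ + n),
            pairT (anisT σ N y k (dirV p q) s) (dropT σ N y k (dirV p q) s) +
          ∑ s ∈ Finset.Ico m₁ (m₁ + n), normSqT (dropT σ N y k (dirV p q) s) := by
    intro k p q
    rw [normSqT_anisT_telescope, Finset.sum_Ico_eq_sum_range, Finset.sum_Ico_eq_sum_range,
      add_tsub_cancel_left]
  unfold anisF workF quadF
  simp_rw [key]
  simp only [Finset.sum_add_distrib, Finset.sum_sub_distrib, ← Finset.mul_sum]
  ring

/-- No work and no floor over an empty stretch. -/
theorem workF_self (m : ℕ) : workF σ N y m m = 0 := by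
  simp [workF]

/-- The floor is nonnegative. -/
theorem quadF_nonneg (m₁ m₂ : ℕ) : 0 ≤ quadF σ N y m₁ m₂ :=
  mul_nonneg (inv_nonneg.2 (Nat.cast_nonneg _)) (Finset.sum_nonneg fun _ _ =>
    Finset.sum_nonneg fun _ _ => Finset.sum_nonneg fun _ _ => Finset.sum_nonneg fun _ _ =>
      Finset.sum_nonneg fun _ _ => sq_nonneg _)

/-- Almost-monotonicity of the anisotropy up to the floor: `anisF m₂ ≤ anisF m₁ + quadF` as soon as
the realised work is nonnegative. -/
theorem anisF_le_of_workF_nonneg {m₁ m₂ : ℕ} (h : m₁ ≤ m₂) (hw : 0 ≤ workF σ N y m₁ m₂) :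
    anisF σ N y m₂ ≤ anisF σ N y m₁ + quadF σ N y m₁ m₂ := by
  rw [anisF_telescope h]
  linarith

/-! ## The two typed inputs of the rank-2 mechanism beyond H1 -/

/-- **INCOHERENT DIFFUSENESS along the line window** at `(σ, profiles, Φ)` — the incoherent twin of
H1 (`DiffuseAt`): for every `t > 0`, with `y = Φ_{t − Δℓ_N} z` under the local Gibbs law, the
cloud-averaged carrier participation of the clouds of all probe impulses at the end of the window
plus the collision-integrated pair participation over the second half `[Δℓ_N/2, Δℓ_N]` of the window
tend to `0` in mean. On forest windows this is H1 (the incoherent and the coherent transport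
coincide); in general they differ by interference terms. It bounds `cd3x` outright and is the floor
`quadF ≤ ½ pairPartF` of the depolarisation balance. Nothing is asserted here. -/
def IncoherentDiffuseAt (σ : ℝ) (a₀ θ₀ : T3 → ℝ) (u₀ : T3 → V3) (Φ : Flows σ) : Prop :=
  ∀ t : ℝ, 0 < t →
    Tendsto (fun N : ℕ => ∫⁻ z, ENNReal.ofReal
      (carrPartF σ N ((Φ N).flow (t - Δℓ N) z) (steps σ N ((Φ N).flow (t - Δℓ N) z) (Δℓ N)) +
        pairPartF σ N ((Φ N).flow (t - Δℓ N) z)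
          (steps σ N ((Φ N).flow (t - Δℓ N) z) (Δℓ N / 2))
          (steps σ N ((Φ N).flow (t - Δℓ N) z) (Δℓ N)))
      ∂(localGibbsLaw σ a₀ u₀ θ₀ N (Φ N))) atTop (𝓝 0)

/-- **ONE-STEP NON-DEGENERACY (OSN) along the line window** at `(σ, profiles, Φ)`, in the integrated
one-sided form the depolarisation mechanism consumes: there is `c₀ > 0` such that for every `K` and
every `t > 0`, with `y = Φ_{t − Δℓ_N} z`, `m = steps σ N y Δℓ_N`, the positive part of
`sup_{j ≤ K(N+1)} [c₀ (N+1)⁻¹ Σ_{m−j ≤ s < m} anisF s − workF (m − j) m]` tends to `0` in local-Gibbs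
mean: on every FINAL STRETCH of at most `K` sweeps the realised first-order depolarisation work of
the impulse clouds is at least `c₀/(N+1)` times the anisotropy summed over the stretch. With normals
uniform on `S²` given the coarse past and the reflected pair, and pairs sampled independently of what
the carriers carry, it holds with any `c₀ < 4/5` (`E[Q S P + P S Q | S] = (2/5) S₀`,
`E[S_s | cloud] = 2 J_s/(N+1)`); it fails for coordinate/planar normal laws and for normal laws
ADAPTED to the carried tensors (recollision towers realising `M = c ⊗ 𝟙₃`). Nothing is asserted here. -/
def OneStepNondegenerateAt (σ : ℝ) (a₀ θ₀ : T3 → ℝ) (u₀ : T3 → V3) (Φ : Flows σ) : Prop :=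
  ∃ c₀ : ℝ, 0 < c₀ ∧ ∀ (K : ℕ) (t : ℝ), 0 < t →
    Tendsto (fun N : ℕ => ∫⁻ z, ENNReal.ofReal
      (let y' := (Φ N).flow (t - Δℓ N) z
       let m := steps σ N y' (Δℓ N)
       ⨆ j : Fin (K * (N + 1) + 1),
         (c₀ * ((N + 1 : ℕ) : ℝ)⁻¹ * ∑ s ∈ Finset.Ico (m - (j : ℕ)) m, anisF σ N y' s -
           workF σ N y' (m - (j : ℕ)) m))
      ∂(localGibbsLaw σ a₀ u₀ θ₀ N (Φ N))) atTop (𝓝 0)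

end

end ColumnDepolarisation
end Summit.AtomisticToContinuum.HydrodynamicLimit.Theorems.ContactSourceDuhamel.TimeLocal
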